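import Literature.AlgebraicGeometry.ShimuraVarieties.UnitaryCurveSliceMorphismPieceFactor
import HarnessLib

/-!
# The pieces of the complex fibre as LEGS of the iterated base change: honest-point factorisation and class reading

Topic `AlgebraicGeometry/ShimuraVarieties`; namespace `Literature.AlgebraicGeometry.ShimuraVarieties.UnitaryCanonicalModel`.  THEOREMS ONLY (no
definition, no named fact, no instance, no notation, no `sorry`).  Cell `hodgecm-mathlib` (D-0151), FLOOR 0, P6 «MOD» (crux hLiu418 =
stmt-HodgeConjecture-24832, `--supports`), E6 ∕ Σ-AN closer of `Cruxes/HLiu418/Lines/F0_P6a_PELWitnessE.lean` (skeleton pen A-p04 (g24), stub `stub_LEGS`,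
deal 2026-09-02T03:00:37Z to LA5-p01 (g0)).  HC_CM is proved only modulo the printed citations (2 remaining named inputs hLiu418 24832, h413 24833) until
rung 0 closes; this file is generic and changes no count.

## The mathematics
`S` a record system of the unitary Shimura curve `Sh(U(J⋆), 𝔻)` read through `τ : L → ℂ`, `K` a small level, `Fᵢ ∕ L` a slice field with `τE : Fᵢ → ℂ`
extending `τ`; `X := (S.M K) ⊗_L Fᵢ` and `Xc := X ⊗_{Fᵢ,τE} ℂ`.  The `pieces` clause of ★ `RecordSystemGS` presents `(S.M K) ⊗_{L,τ} ℂ` as a coproduct of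
disc quotients `X_q` (legs `ι_q`, ball data `B_q`, representatives `g_q` of the double cosets, `ι_q (B_q.unif v) = [v, g_q K]`), and ★ COV-1
(`Motives.exists_towerIso_isColimit_cofan_of_comp_eq`) transports it along the tower isomorphism `e : Xc ≅ (S.M K)_τ` (law `e⁻¹ ≫ pr ≫ pr = pr_τ`).
* `RecordSystemGS.exists_leg_point_of_honest` — **every honest complex point of `Xc` lies on a leg**: for `x̃ : Spec ℂ → Xc` with `x̃ ≫ pr_{Spec ℂ} = 𝟙`
  there are `q` and a negative vector `v` with `(B_q.unif v) ≫ (ι_q ≫ e⁻¹) = x̃`.  Road ([Deligne1979ShimuraVarieties] 2.1.2; [Milne2005ShimuraVarieties]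
  Lemma 5.13): the flat shadow `x♭ := x̃ ≫ pr ≫ pr` is a complex point of `S.M K`, `S.pts x♭ = [v₀, a K]` (★ `ShimuraSetGS.mk_surjective`); the double
  coset of `a` has the record's representative `g_q = γ′ a k`, so `[v₀, aK] = [γ′ v₀, g_q K]` (★ `ShimuraSetGS.mk_eq_mk_iff`); the point `B_q.unif (γ′ v₀)`
  then maps under `ι_q` to `x♭` read in `(S.M K)_τ`, and two honest points of `Xc = ((S.M K) ⊗ Fᵢ) ⊗ ℂ` with the same shadow in `S.M K` coincide
  (`pullback.hom_ext`, twice).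
* `RecordSystemGS.pts_eq_mk_of_leg_point` — **class reading**: if `(B_q.unif v) ≫ (ι_q ≫ e⁻¹) = x̃` then the flat shadow has `S.pts x♭ = [v, g_q K]`
  (★ T1′ `pts_eq_mk_of_piece_point` in honest-point currency).

## References
* [Deligne1979ShimuraVarieties] P. Deligne, *Variétés de Shimura*, PSPM XXXIII.2 (1979), 2.1.2 (the pieces `Γ_g \ X⁺` indexed by `G(ℚ)\G(𝔸^f)/K`).
* [Milne2005ShimuraVarieties] J. S. Milne, *Introduction to Shimura varieties* (2005; rev. 2017), Lemma 5.13 p. 57.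
* [GortzWedhorn2020] U. Görtz, T. Wedhorn, *Algebraic Geometry I* (2nd ed. 2020), (4.7) base change and points (p. 108).
-/

set_option autoImplicit false
set_option backward.isDefEq.respectTransparency false  -- tree-standard hygiene (Mathlib `pullback` seams, as in ★ COV-1)

noncomputable section

open Function Topology NumberField CategoryTheory CategoryTheory.Limits Matrix AlgebraicGeometry Set MulAction
open scoped Matrix ComplexOrder
open Literature.AlgebraicGeometry.Motives Literature.AlgebraicGeometry.Motives.AlgPoints
open Literature.AlgebraicGeometry.Motives.AbelianVariety (bcSpec)
open Literature.NumberTheory.Automorphic.UnitaryGroup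
open Literature.NumberTheory.Automorphic.ShimuraDissection
open Literature.NumberTheory.Automorphic.Liu2021.AppendixC (C5.OpenCompactSubgroup C5.SmallLevel)

namespace Literature.AlgebraicGeometry.ShimuraVarieties.UnitaryCanonicalModel

section Legs

variable {L : Type} [Field L] [NumberField L] [IsCMField L] {Jstar : Matrix (Fin 2) (Fin 2) L} {τ : L →+* ℂ}
  {K₀ : C5.OpenCompactSubgroup ↥(finAdelic (↥(maximalRealSubfield L)) L (IsCMField.complexConj L) 2 Jstar)}
  (S : RecordSystemGS L Jstar τ K₀) (K : C5.SmallLevel K₀)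
  {Fi : Type} [Field Fi] [Algebra L Fi] (τE : Fi →+* ℂ) (hτE : τE.comp (algebraMap L Fi) = τ)
  -- the pieces of `(S.M K)_τ` BY VALUE (the `pieces` clause of ★ `RecordSystemGS`, third conjunct)
  (g : orbitRel.Quotient ↥(rational ↥(maximalRealSubfield L) L (IsCMField.complexConj L) 2 Jstar)
      (CosetSpace (rationalToFinAdelic ↥(maximalRealSubfield L) L (IsCMField.complexConj L) 2 Jstar) K.1.1) →
    ↥(finAdelic ↥(maximalRealSubfield L) L (IsCMField.complexConj L) 2 Jstar))
  (hg : ∀ q, Quotient.mk'' (CosetSpace.pt (rationalToFinAdelic _ L _ 2 Jstar) K.1.1 (g q)) = q)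
  (X : orbitRel.Quotient ↥(rational ↥(maximalRealSubfield L) L (IsCMField.complexConj L) 2 Jstar)
      (CosetSpace (rationalToFinAdelic ↥(maximalRealSubfield L) L (IsCMField.complexConj L) 2 Jstar) K.1.1) → SchemeOver ℂ)
  (ι : ∀ q, X q ⟶ (Motives.baseChangeHom τ).obj (S.M.obj K))
  (B : ∀ q, UnitaryBallUniformisationDatum 1 (X q))
  (hι : letI : Algebra L ℂ := τ.toAlgebra
    ∀ q (v : Fin 2 → ℂ) (hv : v ∈ negCone (Jstar.map τ)),
      AlgPoints.map (ι q) ((B q).unif v) = AlgPoints.baseChangeEquiv τ (S.M.obj K) ((S.pts K).symm (ShimuraSetGS.mk L Jstar τ K.1.1 v hv (g q))))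
  -- the source tower isomorphism (★ COV-1), BY VALUE with its projection law
  (e : letI : Algebra Fi ℂ := τE.toAlgebra
    (Motives.baseChange Fi ℂ).obj ((Motives.baseChange L Fi).obj (S.M.obj K)) ≅ (Motives.baseChangeHom τ).obj (S.M.obj K))
  (he : letI : Algebra Fi ℂ := τE.toAlgebra
    e.inv.left ≫ pullback.fst ((Motives.baseChange L Fi).obj (S.M.obj K)).hom (bcSpec Fi ℂ) ≫ pullback.fst (S.M.obj K).hom (bcSpec L Fi) =
      pullback.fst (S.M.obj K).hom (Spec.map (CommRingCat.ofHom τ)))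

omit [NumberField L] [IsCMField L] in
include hτE in
/-- The structure maps compose: `Spec τE ≫ Spec (L → Fᵢ) = Spec τ`. [cite: GortzWedhorn2020, Section (4.7) p. 108] -/
private theorem bcSpec_comp_bcSpec_eq :
    letI : Algebra Fi ℂ := τE.toAlgebra
    bcSpec Fi ℂ ≫ bcSpec L Fi = Spec.map (CommRingCat.ofHom τ) := by
  letI : Algebra Fi ℂ := τE.toAlgebra
  change Spec.map (CommRingCat.ofHom τE) ≫ Spec.map (CommRingCat.ofHom (algebraMap L Fi)) = _
  rw [← Spec.map_comp, ← CommRingCat.ofHom_comp, hτE]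

set_option maxHeartbeats 400000 in
include hτE hg hι he in
/-- **EVERY COMPLEX POINT OF `Xc = ((S.M K) ⊗_L Fᵢ) ⊗_{τE} ℂ` LIES ON A LEG** ([Deligne1979ShimuraVarieties] 2.1.2: the complex fibre is the disjoint
sum of the `Γ_g \ X⁺` over `G(ℚ)\G(𝔸^f)/K`; [Milne2005ShimuraVarieties] Lemma 5.13).  For an honest complex point `x : Spec ℂ → Xc` over `Spec ℂ` (a
`ComplexPoints` element for the identity algebra `ℂ → ℂ`) there are a double coset `q` and a negative vector `v` of `J⋆^τ` with
`(B_q.unif v) ≫ (ι_q ≫ e⁻¹) = x`: the flat shadow `x♭` of `x` is `[v₀, aK]` (★ `ShimuraSetGS.mk_surjective` on `S.pts x♭`), `γ′ a k = g_q` for the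
record's representative `g_q` (clause `⟦g_q K⟧ = q`), so `[γ′ v₀, g_q K] = [v₀, aK]` (★ `ShimuraSetGS.mk_eq_mk_iff`), the leg point `B_q.unif (γ′ v₀)` maps
under `ι_q` to `x♭` read in `(S.M K)_τ` (clause `ι_q ∘ unif = [·, g_q K]`), and a complex point of the iterated fibre product is determined by its
shadow in `S.M K` (★ `algPoints_baseChangeHom_ext` for `Xc → X`, `pullback.hom_ext` for `X → S.M K`, the tower law `e⁻¹ ≫ pr ≫ pr = pr_τ`).
[cite: Deligne1979ShimuraVarieties, 2.1.2] [cite: Milne2005ShimuraVarieties, Lemma 5.13 p. 57] -/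
theorem RecordSystemGS.exists_leg_point_eq
    (x : letI : Algebra Fi ℂ := τE.toAlgebra
      ComplexPoints ((Motives.baseChange Fi ℂ).obj ((Motives.baseChange L Fi).obj (S.M.obj K)))) :
    letI : Algebra Fi ℂ := τE.toAlgebra
    ∃ (q : orbitRel.Quotient ↥(rational ↥(maximalRealSubfield L) L (IsCMField.complexConj L) 2 Jstar)
        (CosetSpace (rationalToFinAdelic ↥(maximalRealSubfield L) L (IsCMField.complexConj L) 2 Jstar) K.1.1))
      (v : Fin 2 → ℂ) (_ : v ∈ negCone (Jstar.map τ)), AlgPoints.map (ι q ≫ e.inv) ((B q).unif v) = x := by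
  letI : Algebra Fi ℂ := τE.toAlgebra
  letI : Algebra L ℂ := τ.toAlgebra
  -- clean-typed aliases for the projections of the two fibre products
  let fst₁ : ((Motives.baseChange Fi ℂ).obj ((Motives.baseChange L Fi).obj (S.M.obj K))).left ⟶ ((Motives.baseChange L Fi).obj (S.M.obj K)).left :=
    pullback.fst ((Motives.baseChange L Fi).obj (S.M.obj K)).hom (bcSpec Fi ℂ)
  let snd₁ : ((Motives.baseChange Fi ℂ).obj ((Motives.baseChange L Fi).obj (S.M.obj K))).left ⟶ Spec (CommRingCat.of ℂ) :=
    pullback.snd ((Motives.baseChange L Fi).obj (S.M.obj K)).hom (bcSpec Fi ℂ)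
  let fst₂ : ((Motives.baseChange L Fi).obj (S.M.obj K)).left ⟶ (S.M.obj K).left := pullback.fst (S.M.obj K).hom (bcSpec L Fi)
  let snd₂ : ((Motives.baseChange L Fi).obj (S.M.obj K)).left ⟶ Spec (CommRingCat.of Fi) := pullback.snd (S.M.obj K).hom (bcSpec L Fi)
  let fstτ : ((Motives.baseChangeHom τ).obj (S.M.obj K)).left ⟶ (S.M.obj K).left := pullback.fst (S.M.obj K).hom (Spec.map (CommRingCat.ofHom τ))
  have hc₁ : fst₁ ≫ snd₂ = snd₁ ≫ bcSpec Fi ℂ := pullback.condition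
  have hc₂ : fst₂ ≫ (S.M.obj K).hom = snd₂ ≫ bcSpec L Fi := pullback.condition
  have he₁ : e.inv.left ≫ fst₁ ≫ fst₂ = fstτ := he
  have hss : bcSpec Fi ℂ ≫ bcSpec L Fi = Spec.map (CommRingCat.ofHom τ) := bcSpec_comp_bcSpec_eq τE hτE
  -- every complex point `P` of `Xc` is honest: `P ≫ pr_{Spec ℂ} ≫ Spec τE = (Spec ℂ → Spec ℂ) ≫ Spec τE`
  have hhon : ∀ P : ComplexPoints ((Motives.baseChange Fi ℂ).obj ((Motives.baseChange L Fi).obj (S.M.obj K))),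
      P.left ≫ fst₁ ≫ snd₂ = (specOver ℂ ℂ).hom ≫ bcSpec Fi ℂ := fun P => by
    have hw : P.left ≫ snd₁ = (specOver ℂ ℂ).hom := Over.w P
    rw [hc₁, ← Category.assoc, hw]
  -- §1 the flat shadow `x♭ ∈ (S.M K)(ℂ)` (along `τ`) and its class `[v₀, aK]`
  have hwflat : (x.left ≫ fst₁ ≫ fst₂) ≫ (S.M.obj K).hom = Spec.map (CommRingCat.ofHom (algebraMap L ℂ)) := by
    change (x.left ≫ fst₁ ≫ fst₂) ≫ (S.M.obj K).hom = Spec.map (CommRingCat.ofHom τ)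
    calc (x.left ≫ fst₁ ≫ fst₂) ≫ (S.M.obj K).hom = x.left ≫ fst₁ ≫ (fst₂ ≫ (S.M.obj K).hom) := by simp only [Category.assoc]
      _ = (x.left ≫ fst₁ ≫ snd₂) ≫ bcSpec L Fi := by rw [hc₂]; simp only [Category.assoc]
      _ = (specOver ℂ ℂ).hom ≫ bcSpec Fi ℂ ≫ bcSpec L Fi := by rw [hhon x, Category.assoc]
      _ = Spec.map (CommRingCat.ofHom τ) := by
          rw [hss]
          change Spec.map (CommRingCat.ofHom (algebraMap ℂ ℂ)) ≫ _ = _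
          rw [Algebra.algebraMap_self, CommRingCat.ofHom_id, Spec.map_id, Category.id_comp]
  let Pflat : ComplexPoints (S.M.obj K) := AlgPoints.mk (x.left ≫ fst₁ ≫ fst₂) hwflat
  have hPflat : Pflat.left = x.left ≫ fst₁ ≫ fst₂ := rfl
  obtain ⟨v₀, hv₀, a, hva⟩ := ShimuraSetGS.mk_surjective L Jstar τ K.1.1 (S.pts K Pflat)
  -- §2 the record's representative of the double coset of `a`: `⟦g_q K⟧ = ⟦a K⟧`, `γ′ • aK = g_q K`
  obtain ⟨q, hqdef⟩ : ∃ q : orbitRel.Quotient ↥(rational ↥(maximalRealSubfield L) L (IsCMField.complexConj L) 2 Jstar)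
      (CosetSpace (rationalToFinAdelic ↥(maximalRealSubfield L) L (IsCMField.complexConj L) 2 Jstar) K.1.1),
      q = Quotient.mk'' (CosetSpace.pt (rationalToFinAdelic _ L _ 2 Jstar) K.1.1 a) := ⟨_, rfl⟩
  have hq : Quotient.mk'' (CosetSpace.pt (rationalToFinAdelic _ L _ 2 Jstar) K.1.1 (g q)) =
      Quotient.mk'' (CosetSpace.pt (rationalToFinAdelic _ L _ 2 Jstar) K.1.1 a) := (hg q).trans hqdef
  obtain ⟨γ', hγ'⟩ := mem_orbit_iff.mp (Quotient.eq''.mp hq)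
  rw [CosetSpace.smul_pt, CosetSpace.pt_eq_pt_iff] at hγ'
  -- the moved vector `v := γ′^τ v₀` and the class identity `[v, g_q K] = [v₀, aK]`
  have hv : (1 : ℂ) • ((((ratToGLℂ L Jstar τ γ' : GL (Fin 2) ℂ)) : Matrix (Fin 2) (Fin 2) ℂ) *ᵥ v₀) ∈ negCone (Jstar.map τ) :=
    smul_ratToGLℂ_mulVec_mem_negCone L Jstar τ γ' one_ne_zero hv₀
  have hclass : ShimuraSetGS.mk L Jstar τ K.1.1 _ hv (g q) = ShimuraSetGS.mk L Jstar τ K.1.1 v₀ hv₀ a := by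
    rw [ShimuraSetGS.mk_eq_mk_iff]
    refine ⟨γ', 1, one_ne_zero, rfl, ?_⟩
    rw [MulAction.Quotient.smul_coe, smul_eq_mul, QuotientGroup.eq]
    exact hγ'
  set v₁ : Fin 2 → ℂ := (1 : ℂ) • ((((ratToGLℂ L Jstar τ γ' : GL (Fin 2) ℂ)) : Matrix (Fin 2) (Fin 2) ℂ) *ᵥ v₀) with hv₁def
  refine ⟨q, v₁, hv, ?_⟩
  -- §3 the leg point has the same shadow in `S.M K` as `x`
  have hlegτ : ((B q).unif v₁).left ≫ (ι q).left ≫ fstτ = x.left ≫ fst₁ ≫ fst₂ := by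
    have h1 := AlgPoints.baseChangeEquiv_apply_left_comp_fst τ (S.M.obj K)
      ((S.pts K).symm (ShimuraSetGS.mk L Jstar τ K.1.1 v₁ hv (g q)))
    rw [← hι q v₁ hv] at h1
    rw [hclass, hva, Homeomorph.symm_apply_apply, hPflat] at h1
    rw [← h1]
    change _ = (((B q).unif v₁).left ≫ (ι q).left) ≫ fstτ
    simp only [Category.assoc]
  -- §4 compare: complex points of `Xc` are determined by their projection to `X`, and those by (shadow, structure map)
  apply algPoints_baseChangeHom_ext (algebraMap Fi ℂ) ((Motives.baseChange L Fi).obj (S.M.obj K))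
  change (AlgPoints.map (ι q ≫ e.inv) ((B q).unif v₁)).left ≫ fst₁ = x.left ≫ fst₁
  apply pullback.hom_ext
  · calc ((AlgPoints.map (ι q ≫ e.inv) ((B q).unif v₁)).left ≫ fst₁) ≫ fst₂
        = ((B q).unif v₁).left ≫ (ι q).left ≫ (e.inv.left ≫ fst₁ ≫ fst₂) := by
          change ((((B q).unif v₁).left ≫ (ι q ≫ e.inv).left) ≫ fst₁) ≫ fst₂ = _
          simp only [Over.comp_left, Category.assoc]
      _ = ((B q).unif v₁).left ≫ (ι q).left ≫ fstτ := by rw [he₁]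
      _ = x.left ≫ fst₁ ≫ fst₂ := hlegτ
      _ = (x.left ≫ fst₁) ≫ fst₂ := (Category.assoc _ _ _).symm
  · calc ((AlgPoints.map (ι q ≫ e.inv) ((B q).unif v₁)).left ≫ fst₁) ≫ snd₂
        = (AlgPoints.map (ι q ≫ e.inv) ((B q).unif v₁)).left ≫ fst₁ ≫ snd₂ := Category.assoc _ _ _
      _ = (specOver ℂ ℂ).hom ≫ bcSpec Fi ℂ := hhon _
      _ = x.left ≫ fst₁ ≫ snd₂ := (hhon x).symm
      _ = (x.left ≫ fst₁) ≫ snd₂ := (Category.assoc _ _ _).symm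

include he hι in
/-- **CLASS READING OF A LEG POINT** (★ T1′ `pts_eq_mk_of_piece_point` in leg-point currency): if the complex point `x` of `Xc` is
`(B_q.unif v) ≫ (ι_q ≫ e⁻¹)`, then its flat shadow `x♭` (`x♭ = x ≫ pr ≫ pr`) has `S.pts x♭ = [v, g_q K]`.
[cite: Milne2005ShimuraVarieties, Lemma 5.13 p. 57] [cite: Deligne1979ShimuraVarieties, 2.1.2] -/
theorem RecordSystemGS.pts_eq_mk_of_leg_point_eq (q : orbitRel.Quotient ↥(rational ↥(maximalRealSubfield L) L (IsCMField.complexConj L) 2 Jstar)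
      (CosetSpace (rationalToFinAdelic ↥(maximalRealSubfield L) L (IsCMField.complexConj L) 2 Jstar) K.1.1))
    (v : Fin 2 → ℂ) (hv : v ∈ negCone (Jstar.map τ))
    (x : letI : Algebra Fi ℂ := τE.toAlgebra
      ComplexPoints ((Motives.baseChange Fi ℂ).obj ((Motives.baseChange L Fi).obj (S.M.obj K))))
    (hx : letI : Algebra Fi ℂ := τE.toAlgebra
      AlgPoints.map (ι q ≫ e.inv) ((B q).unif v) = x)
    (Pflat : letI : Algebra L ℂ := τ.toAlgebra; ComplexPoints (S.M.obj K))
    (hPflat : letI : Algebra Fi ℂ := τE.toAlgebra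
      Pflat.left = (x.left ≫ pullback.fst ((Motives.baseChange L Fi).obj (S.M.obj K)).hom (bcSpec Fi ℂ)) ≫
        pullback.fst (S.M.obj K).hom (bcSpec L Fi)) :
    letI : Algebra L ℂ := τ.toAlgebra
    S.pts K Pflat = ShimuraSetGS.mk L Jstar τ K.1.1 v hv (g q) := by
  letI : Algebra Fi ℂ := τE.toAlgebra
  letI : Algebra L ℂ := τ.toAlgebra
  subst hx
  -- the point `x ≫ pr` of `X = (S.M K) ⊗_L Fᵢ` along `τE`
  let xP : ComplexPoints ((Motives.baseChange L Fi).obj (S.M.obj K)) :=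
    (AlgPoints.baseChangeEquiv (algebraMap Fi ℂ) ((Motives.baseChange L Fi).obj (S.M.obj K))).symm
      (AlgPoints.map (ι q ≫ e.inv) ((B q).unif v))
  have hxP : xP.left = (AlgPoints.map (ι q ≫ e.inv) ((B q).unif v)).left ≫
      pullback.fst ((Motives.baseChange L Fi).obj (S.M.obj K)).hom (bcSpec Fi ℂ) :=
    AlgPoints.baseChangeEquiv_symm_apply_left (algebraMap Fi ℂ) _ _
  refine pts_eq_mk_of_piece_point S K τE e he (X q) (B q) (ι q) (g q) (hι q) v hv xP Pflat ?_ ?_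
  · rw [hPflat, hxP, Category.assoc]
  · rw [hxP]
    rfl

include hτE hg hι he in
/-- **Raw form of `exists_leg_point_eq`**: for a morphism `x̃ : Spec ℂ → Xc` with `x̃ ≫ pr_{Spec ℂ} = 𝟙` (an honest point in scheme currency)
there are `q` and a negative `v` with `(B_q.unif v).left ≫ (ι_q ≫ e⁻¹).left = x̃`. [cite: Deligne1979ShimuraVarieties, 2.1.2]
[cite: Milne2005ShimuraVarieties, Lemma 5.13 p. 57] -/
theorem RecordSystemGS.exists_leg_point_of_honest
    (x : letI : Algebra Fi ℂ := τE.toAlgebra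
      Spec (CommRingCat.of ℂ) ⟶ ((Motives.baseChange Fi ℂ).obj ((Motives.baseChange L Fi).obj (S.M.obj K))).left)
    (hx : letI : Algebra Fi ℂ := τE.toAlgebra
      x ≫ pullback.snd ((Motives.baseChange L Fi).obj (S.M.obj K)).hom (bcSpec Fi ℂ) = 𝟙 _) :
    letI : Algebra Fi ℂ := τE.toAlgebra
    ∃ (q : orbitRel.Quotient ↥(rational ↥(maximalRealSubfield L) L (IsCMField.complexConj L) 2 Jstar)
        (CosetSpace (rationalToFinAdelic ↥(maximalRealSubfield L) L (IsCMField.complexConj L) 2 Jstar) K.1.1))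
      (v : Fin 2 → ℂ) (_ : v ∈ negCone (Jstar.map τ)), ((B q).unif v).left ≫ (ι q ≫ e.inv).left = x := by
  letI : Algebra Fi ℂ := τE.toAlgebra
  have hw : x ≫ ((Motives.baseChange Fi ℂ).obj ((Motives.baseChange L Fi).obj (S.M.obj K))).hom =
      Spec.map (CommRingCat.ofHom (algebraMap ℂ ℂ)) := by
    rw [Algebra.algebraMap_self, CommRingCat.ofHom_id, Spec.map_id]
    exact hx
  obtain ⟨q, v, hv, hqv⟩ := S.exists_leg_point_eq K τE hτE g hg X ι B hι e he (AlgPoints.mk x hw)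
  exact ⟨q, v, hv, congrArg CommaMorphism.left hqv⟩

include he hι in
/-- **Raw form of `pts_eq_mk_of_leg_point_eq`**: if `(B_q.unif v).left ≫ (ι_q ≫ e⁻¹).left = x̃` then the flat shadow `x♭` of `x̃`
(`x♭.left = (x̃ ≫ pr) ≫ pr`) has `S.pts x♭ = [v, g_q K]`. [cite: Milne2005ShimuraVarieties, Lemma 5.13 p. 57] [cite: Deligne1979ShimuraVarieties, 2.1.2] -/
theorem RecordSystemGS.pts_eq_mk_of_leg_point (q : orbitRel.Quotient ↥(rational ↥(maximalRealSubfield L) L (IsCMField.complexConj L) 2 Jstar)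
      (CosetSpace (rationalToFinAdelic ↥(maximalRealSubfield L) L (IsCMField.complexConj L) 2 Jstar) K.1.1))
    (v : Fin 2 → ℂ) (hv : v ∈ negCone (Jstar.map τ))
    (x : letI : Algebra Fi ℂ := τE.toAlgebra
      Spec (CommRingCat.of ℂ) ⟶ ((Motives.baseChange Fi ℂ).obj ((Motives.baseChange L Fi).obj (S.M.obj K))).left)
    (hx : letI : Algebra Fi ℂ := τE.toAlgebra
      ((B q).unif v).left ≫ (ι q ≫ e.inv).left = x)
    (Pflat : letI : Algebra L ℂ := τ.toAlgebra; ComplexPoints (S.M.obj K))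
    (hPflat : letI : Algebra Fi ℂ := τE.toAlgebra
      Pflat.left = (x ≫ pullback.fst ((Motives.baseChange L Fi).obj (S.M.obj K)).hom (bcSpec Fi ℂ)) ≫
        pullback.fst (S.M.obj K).hom (bcSpec L Fi)) :
    letI : Algebra L ℂ := τ.toAlgebra
    S.pts K Pflat = ShimuraSetGS.mk L Jstar τ K.1.1 v hv (g q) := by
  letI : Algebra Fi ℂ := τE.toAlgebra
  subst hx
  exact S.pts_eq_mk_of_leg_point_eq K τE g X ι B hι e he q v hv (AlgPoints.map (ι q ≫ e.inv) ((B q).unif v)) rfl Pflat hPflat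

end Legs

end Literature.AlgebraicGeometry.ShimuraVarieties.UnitaryCanonicalModel

end
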